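import Summits.BirchSwinnertonDyer.BirchSwinnertonDyer.Theorems.BiquadraticEisensteinDescentEisensteinHeartFlatCMInertBadKPrimeDeuringOverKPrimeResidueDegree
import Literature.NumberTheory.NumberFields.QuadraticExtensionInertiaProofs
import HarnessLib

set_option linter.dupNamespace false -- `Summit.BirchSwinnertonDyer.BirchSwinnertonDyer.Theorems.…` (summit = sub)
set_option autoImplicit false

/-!
# Crux `EisensteinHeartFlatCMInertBadKPrime` (stmt-BirchSwinnertonDyer-21341), line `hsieh-lambda`, layer 2 (V2), hypothesis (L):
# the side condition `hramL` of `…DeuringOverKPrime.polynomial_identity` reduced to the CM field alone (inertia at a ramified place)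

Route `BiquadraticEisensteinDescent` (cell `pub/bsd-wall`, width seat `bsd-wall-cm-bed-w3`). THEOREMS ONLY (no definition, no named
fact, no `sorry`); supports stmt-BirchSwinnertonDyer-21341 as a helper; nothing about the crux's input or any case of BSD is asserted.

`hramL` ("`L/K′` ramifies only above bad primes of `W`") is PROVED here (`not_hasGoodReductionAtPrime_of_ramificationIdx_eq_two`)
from data on the CM field `K₁` only: `θ₀ ∈ 𝓞 K₁`, `a ∈ ℤ` with `c θ₀ = a − θ₀`, and the K₁-statement «every rational prime `ℓ` lying
under a prime `𝔮` of `K₁` containing `a − 2θ₀` (`= ∓√d_CM` or `−2√d_CM`) is a bad prime of `W`» (for the nine CM fields: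
`√d ∈ 𝔮 ∋ ℓ ⇒ ℓ ∣ d ⇒ ℓ` ramified in `K₁ ⇒ L_ℓ(W) = 1`, `Deuring_localEulerFactor_ramified`; plus `ℓ = 2` when `a = 0`).
Proof: if `e(w|v) = 2` then `τ` lies in the inertia group at `w` (`QuadraticExtensionInertiaProofs`), so
`a − 2θ₀ = (τθ₀ − θ₀) − … ∈ w ∩ 𝓞 K₁`.

References: [NeukirchANT1999] Ch. I §9 (9.6); [SilvermanATAEC1994] App. A §3; Ch. II Ex. 2.31 (a).
-/

noncomputable section

open scoped NumberField Pointwise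
open NumberField IsDedekindDomain Ideal
open Literature.NumberTheory.GaloisRepresentations Literature.NumberTheory.EllipticCurves Literature.NumberTheory.NumberFields
open Literature.NumberTheory.Automorphic
open Summit.BirchSwinnertonDyer.BirchSwinnertonDyer.Theorems.BiquadraticEisensteinDescentEisensteinHeartFlatCMInertBadKPrimeDeuringOverKPrime
open Summit.BirchSwinnertonDyer.BirchSwinnertonDyer.Theorems.BiquadraticEisensteinDescentEisensteinHeartFlatCMInertBadKPrimeDeuringOverKPrimeResidueDegree

namespace Summit.BirchSwinnertonDyer.BirchSwinnertonDyer.Theorems.BiquadraticEisensteinDescentEisensteinHeartFlatCMInertBadKPrimeDeuringOverKPrimeRamification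

variable {K₁ K L : Type} [Field K₁] [NumberField K₁] [Field K] [NumberField K] [Field L] [NumberField L]
  [Algebra K₁ L] [IsGalois K₁ L] [Algebra K L] [IsGalois K L] [IsGalois ℚ K₁]

omit [IsGalois K₁ L] in
/-- **`hramL` from the CM field: `L/K′` ramifies only above bad primes.** Setting as in
`…ResidueDegree.absNorm_eq_minFac_of_inertiaDeg_eq_two` (`τ ∈ Gal(L/K)` non-trivial acting on `K₁` as `c`; `θ₀ ∈ 𝓞 K₁`, `a ∈ ℤ`,
`c θ₀ = a − θ₀`), plus: every rational prime `ℓ` below a prime `𝔮` of `K₁` containing `a − 2θ₀` is a bad prime of `W`. Then for every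
`w ∣ v` of `L/K` with `e(w|v) = 2` and every rational prime `ℓ ∈ v`, `W` has bad reduction at `ℓ` — the hypothesis `hramL` of
`…DeuringOverKPrime.polynomial_identity` / `…KatzHsiehLValue.hLval_of_deuring`. [cite: NeukirchANT1999, Ch. I §9 (9.6)]
[cite: SilvermanATAEC1994, Ch. II Ex. 2.31 (a) (p. 179)] -/
theorem not_hasGoodReductionAtPrime_of_ramificationIdx_eq_two (W : WeierstrassCurve ℚ) (h2L : Module.finrank K L = 2)
    (c : K₁ ≃ₐ[ℚ] K₁) {τ : L ≃ₐ[K] L} (hτ : τ ≠ 1) (hτc : (τ.restrictScalars ℚ).restrictNormal K₁ = c) (θ₀ : 𝓞 K₁) (a : ℤ)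
    (hcθ : c • θ₀ = (a : 𝓞 K₁) - θ₀)
    (hθram : ∀ (ℓ : ℕ) [Fact ℓ.Prime] (𝔮 : HeightOneSpectrum (𝓞 K₁)), (ℓ : 𝓞 K₁) ∈ 𝔮.asIdeal →
      (a : 𝓞 K₁) - 2 * θ₀ ∈ 𝔮.asIdeal → ¬ W.HasGoodReductionAtPrime ℓ)
    (ℓ : ℕ) [Fact ℓ.Prime] (w : HeightOneSpectrum (𝓞 L)) (v : HeightOneSpectrum (𝓞 K)) (hw : w.under (𝓞 K) = v)
    (hℓ : (ℓ : 𝓞 K) ∈ v.asIdeal) (he : w.asIdeal.ramificationIdx (𝓞 K) = 2) : ¬ W.HasGoodReductionAtPrime ℓ := by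
  set Θ : 𝓞 L := algebraMap (𝓞 K₁) (𝓞 L) θ₀ with hΘ
  have hin := smul_sub_mem_of_ramificationIdx_eq_two h2L hτ hw he Θ
  have hτΘ : τ • Θ = (a : 𝓞 L) - Θ := by
    rw [hΘ, BiquadraticEisensteinDescentEisensteinHeartFlatCMInertBadKPrimeDeuringOverKPrimeResidueDegree.smul_algebraMap_eq, hτc,
      hcθ, map_sub, map_intCast]
  rw [hτΘ, show (a : 𝓞 L) - Θ - Θ = (a : 𝓞 L) - 2 * Θ by ring] at hin
  set 𝔮 : HeightOneSpectrum (𝓞 K₁) := w.under (𝓞 K₁) with h𝔮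
  have hmem₁ : (a : 𝓞 K₁) - 2 * θ₀ ∈ 𝔮.asIdeal := by
    have : algebraMap (𝓞 K₁) (𝓞 L) ((a : 𝓞 K₁) - 2 * θ₀) ∈ w.asIdeal := by
      rw [map_sub, map_mul, map_intCast, map_ofNat]; exact hin
    have h' : (a : 𝓞 K₁) - 2 * θ₀ ∈ (w.under (𝓞 K₁)).asIdeal := by
      rw [HeightOneSpectrum.under_asIdeal, Ideal.under_def, Ideal.mem_comap]; exact this
    exact h'
  have hℓw : (ℓ : 𝓞 L) ∈ w.asIdeal := (natCast_mem_iff_of_under_eq hw ℓ).mp hℓ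
  have hℓ𝔮 : (ℓ : 𝓞 K₁) ∈ 𝔮.asIdeal := (natCast_mem_iff_of_under_eq (K := K₁) rfl ℓ).mpr hℓw
  exact hθram ℓ 𝔮 hℓ𝔮 hmem₁

end Summit.BirchSwinnertonDyer.BirchSwinnertonDyer.Theorems.BiquadraticEisensteinDescentEisensteinHeartFlatCMInertBadKPrimeDeuringOverKPrimeRamification

end
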